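import Mathlib

/-!
# LitHurwitzZero — `ζ(0, a) = 1/2 − a` for `0 < a ≤ 1` (Mathlib's `HurwitzZetaValues` TODO)

Blind cell `pub-hodge-repro`, seat lit-2 (gen 6).  Built on Mathlib only.

The rank lane of this seat had reduced Kubota 1965's Lemma 3 (Leopoldt) and Theorem 2 to ONE
analytic sentence, `Θ = Σ_{a=1}^{p−1} ψ(a)·a ≠ 0` for odd `ψ` mod an odd prime `p` (Kubota 1965,
store `paper:doi-10-1090-s0002-9947-1965-0190144-8`, p0008:L41–L46: "Θ is a factor contained in
the class number formula"), i.e. `L(0, ψ) = −B_{1,ψ} = −Θ/p ≠ 0`.  Mathlib lacks `L(χ, 0)`: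
`hurwitzZeta a 0` is left open in `Mathlib/NumberTheory/LSeries/HurwitzZetaValues.lean`
(`hurwitzZeta_neg_nat` needs `k ≠ 0`; its TODO: the `s = 0` case "requires Fourier series which
are only conditionally convergent").  This file proves it WITHOUT Fourier series:

* `trapezoid`: `∫_c^{c+1} (u_c(t)·s(s+1)·t^{−s−2} − t^{−s}) dt = −(c^{−s} + (c+1)^{−s})/2` for
  `c > 0`, `u_c(t) = ((t−c)² − (t−c))/2` — one FTC application to `H = u·g' − u'·g`, `g = t^{−s}`;
* `sum_step`, `hurwitzZeta_eq_EM` (`Re s > 1`, `0 < a ≤ 1`): telescoping and `M → ∞` give the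
  second-order Euler–Maclaurin formula `ζ(s, a) = a^{1−s}/(s−1) + a^{−s}/2 − s(s+1)·J a s`,
  `J a s = ∫_a^∞ P₂(t − a)·t^{−s−2} dt`, `P₂(y) = ({y}² − {y})/2`;
* `differentiableAt_J`: `J a` is holomorphic on `Re s > −1` (Mellin transform of the bounded
  kernel `1_{t > a}·P₂(t − a)` at `−s − 1`, `mellin_differentiableAt_of_isBigO_rpow`);
* `hurwitzZeta_zero_eq`: the entire `Φ(s) = (s−1)·ζ(s, a)` and the holomorphic
  `(s−1)·(a^{1−s}/(s−1) + a^{−s}/2 − s(s+1)·J a s)` agree on `Re s > 1`, hence on the half plane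
  `Re s > −1` (identity theorem); at `s = 0`: **`ζ(0, a) = 1/2 − a`**.

`LitLFunctionZero.lean` / `LitRankTheta.lean` (same seat) derive `L(χ, 0) = −(1/N)·Σ χ(j)·j`,
`L(χ, 0) ≠ 0` for odd `χ` of prime modulus, and Kubota's `Θ ≠ 0` (reference for the value:
Washington, *Introduction to Cyclotomic Fields*, Thm 4.2; the proof here is self-contained).
-/

namespace HodgeRepro.Lit2.HurwitzZero

open Complex Real Set MeasureTheory Filter Topology intervalIntegral HurwitzZeta

/-- The periodic second Bernoulli-type function `P₂(y) = ({y}² − {y})/2`. -/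
noncomputable def P2 (y : ℝ) : ℝ := (Int.fract y ^ 2 - Int.fract y) / 2

/-- `|P₂(y)| ≤ 1/8`. -/
lemma P2_bound (y : ℝ) : |P2 y| ≤ 1 / 8 := by
  unfold P2
  have h0 := Int.fract_nonneg y
  have h1 := Int.fract_lt_one y
  rw [abs_le]
  constructor <;> nlinarith [sq_nonneg (Int.fract y - 1 / 2)]

/-- `P₂` is measurable. -/
lemma measurable_P2 : Measurable P2 := by unfold P2; fun_prop

/-- derivative of `t ↦ t^c` (real `t > 0`, complex exponent). -/
lemma hasDerivAt_cpow_real {t : ℝ} (ht : 0 < t) (c : ℂ) :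
    HasDerivAt (fun y : ℝ => (y : ℂ) ^ c) (c * (t : ℂ) ^ (c - 1)) t :=
  (Complex.hasStrictDerivAt_cpow_const (ofReal_mem_slitPlane.2 ht)).hasDerivAt.comp_ofReal

/-- The polynomial weight on `[c, c+1]`: `u_c(t) = ((t−c)² − (t−c))/2`. -/
noncomputable def u (c t : ℝ) : ℝ := ((t - c) ^ 2 - (t - c)) / 2

/-- **Trapezoid identity with exact remainder** on `[c, c+1]`, `c > 0`:
`∫_c^{c+1} (u_c(t)·s(s+1)t^{−s−2} − t^{−s}) dt = −(c^{−s} + (c+1)^{−s})/2`. -/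
lemma trapezoid (c : ℝ) (hc : 0 < c) (s : ℂ) :
    ∫ t in c..(c + 1), ((u c t : ℂ) * (s * (s + 1) * (t : ℂ) ^ (-s - 2)) - (t : ℂ) ^ (-s))
      = -(((c : ℂ) ^ (-s) + ((c : ℂ) + 1) ^ (-s)) / 2) := by
  -- antiderivative H(t) = u(t)·(−s t^{−s−1}) − u'(t)·t^{−s}, u'(t) = (t − c) − 1/2
  have key : ∀ t ∈ uIcc c (c + 1),
      HasDerivAt (fun t : ℝ => (u c t : ℂ) * (-s * (t : ℂ) ^ (-s - 1)) -
          (((t - c) - 1 / 2 : ℝ) : ℂ) * (t : ℂ) ^ (-s))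
        ((u c t : ℂ) * (s * (s + 1) * (t : ℂ) ^ (-s - 2)) - (t : ℂ) ^ (-s)) t := by
    intro t ht
    have ht0 : 0 < t := by rw [uIcc_of_le (by linarith)] at ht; linarith [ht.1]
    have hu : HasDerivAt (fun t : ℝ => (u c t : ℂ)) ((((t - c) - 1 / 2 : ℝ) : ℂ)) t := by
      have : HasDerivAt (fun t : ℝ => u c t) ((t - c) - 1 / 2) t := by
        unfold u
        have h1 : HasDerivAt (fun t : ℝ => t - c) 1 t := (hasDerivAt_id t).sub_const c
        have h2 := ((h1.pow 2).sub h1).div_const 2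
        refine h2.congr_deriv ?_
        norm_num; ring
      exact this.ofReal_comp
    have hu' : HasDerivAt (fun t : ℝ => ((((t - c) - 1 / 2 : ℝ)) : ℂ)) (1 : ℂ) t := by
      have : HasDerivAt (fun t : ℝ => (t - c) - 1 / 2) 1 t :=
        ((hasDerivAt_id t).sub_const c).sub_const _
      simpa using this.ofReal_comp
    have hp1 := hasDerivAt_cpow_real ht0 (-s - 1)
    have hp0 := hasDerivAt_cpow_real ht0 (-s)
    have := (hu.mul (hp1.const_mul (-s))).sub (hu'.mul hp0)
    refine this.congr_deriv ?_
    rw [show (-s - 1 - 1 : ℂ) = -s - 2 by ring]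
    have e3 : (t : ℂ) ^ (-s - 1) = (t : ℂ) ^ (-s) * (t : ℂ) ^ (-1 : ℂ) := by
      rw [← cpow_add _ _ (by exact_mod_cast ht0.ne')]; ring_nf
    have e4 : (t : ℂ) ^ (-s - 2) = (t : ℂ) ^ (-s) * (t : ℂ) ^ (-2 : ℂ) := by
      rw [← cpow_add _ _ (by exact_mod_cast ht0.ne')]; ring_nf
    rw [e3, e4]
    have e5 : (t : ℂ) ^ (-1 : ℂ) = ((t : ℂ))⁻¹ := cpow_neg_one _
    have e6 : (t : ℂ) ^ (-2 : ℂ) = ((t : ℂ)^2)⁻¹ := by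
      rw [show (-2 : ℂ) = -((2 : ℕ) : ℂ) by norm_num, cpow_neg, cpow_natCast]
    rw [e5, e6]
    unfold u
    have htne : (t : ℂ) ≠ 0 := by exact_mod_cast ht0.ne'
    push_cast
    field_simp
    ring
  have hint : IntervalIntegrable
      (fun t : ℝ => (u c t : ℂ) * (s * (s + 1) * (t : ℂ) ^ (-s - 2)) - (t : ℂ) ^ (-s))
      volume c (c + 1) := by
    have hcp : ∀ r : ℂ, IntervalIntegrable (fun t : ℝ => (t : ℂ) ^ r) volume c (c + 1) := fun r =>
      intervalIntegrable_cpow (Or.inr (by rw [mem_uIcc]; rintro (⟨h, -⟩ | ⟨h, -⟩) <;> linarith))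
    have hu : ContinuousOn (fun t : ℝ => (u c t : ℂ)) (uIcc c (c + 1)) :=
      (continuous_ofReal.comp (by unfold u; fun_prop)).continuousOn
    exact (((hcp (-s - 2)).const_mul (s * (s + 1))).continuousOn_mul hu).sub (hcp (-s))
  rw [integral_eq_sub_of_hasDerivAt key hint]
  unfold u
  simp only [sub_self, add_sub_cancel_left]
  push_cast; ring

/-- `J a s = ∫_a^∞ P₂(t − a)·t^{−s−2} dt` (absolutely convergent for `Re s > −1`). -/
noncomputable def J (a : ℝ) (s : ℂ) : ℂ := ∫ t in Ioi a, (P2 (t - a) : ℂ) * (t : ℂ) ^ (-s - 2)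

/-- `t ↦ P₂(t − a)` (as a complex function) is a.e.-strongly measurable. -/
lemma aestronglyMeasurable_P2 (a : ℝ) (μ : Measure ℝ) :
    AEStronglyMeasurable (fun t : ℝ => (P2 (t - a) : ℂ)) μ :=
  (continuous_ofReal.measurable.comp <|
    measurable_P2.comp <| measurable_id.sub_const a).aestronglyMeasurable

/-- `‖P₂(t − a)‖ ≤ 1/8`. -/
lemma norm_P2_le (a t : ℝ) : ‖(P2 (t - a) : ℂ)‖ ≤ 1 / 8 := by
  rw [Complex.norm_real, Real.norm_eq_abs]
  exact P2_bound _

/-- the integrand of `J a s` is integrable on `(a, ∞)` for `Re s > −1` (`a > 0`). -/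
lemma integrableOn_J_integrand (a : ℝ) (ha : 0 < a) {s : ℂ} (hs : -1 < s.re) :
    IntegrableOn (fun t : ℝ => (P2 (t - a) : ℂ) * (t : ℂ) ^ (-s - 2)) (Ioi a) := by
  have hg : IntegrableOn (fun t : ℝ => (t : ℂ) ^ (-s - 2)) (Ioi a) :=
    integrableOn_Ioi_cpow_of_lt (by simp; linarith) ha
  exact hg.bdd_mul (aestronglyMeasurable_P2 a _) (Eventually.of_forall fun t => norm_P2_le a t)

/-- multiplying an interval-integrable function by the bounded `P₂(t − a)` keeps it integrable. -/
lemma P2_mul_intervalIntegrable {g : ℝ → ℂ} {x y : ℝ} (hg : IntervalIntegrable g volume x y)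
    (a : ℝ) : IntervalIntegrable (fun t => (P2 (t - a) : ℂ) * g t) volume x y := by
  rw [intervalIntegrable_iff] at hg ⊢
  exact hg.bdd_mul (aestronglyMeasurable_P2 a _) (Eventually.of_forall fun t => norm_P2_le a t)

/-- `t ↦ t^r` is interval integrable on `[x, y] ⊂ (0, ∞)`. -/
lemma intervalIntegrable_cpow_pos {x y : ℝ} (hx : 0 < x) (hy : 0 < y) (r : ℂ) :
    IntervalIntegrable (fun t : ℝ => (t : ℂ) ^ r) volume x y :=
  intervalIntegrable_cpow (Or.inr (by
    rw [mem_uIcc]; rintro (⟨h, -⟩ | ⟨h, -⟩) <;> linarith))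

/-- the integrand of the trapezoid identity is interval integrable on `[x, y] ⊂ (0, ∞)`. -/
lemma intervalIntegrable_trap (a : ℝ) (s : ℂ) {x y : ℝ} (hx : 0 < x) (hy : 0 < y) :
    IntervalIntegrable
      (fun t : ℝ => (P2 (t - a) : ℂ) * (s * (s + 1) * (t : ℂ) ^ (-s - 2)) - (t : ℂ) ^ (-s))
      volume x y :=
  (P2_mul_intervalIntegrable ((intervalIntegrable_cpow_pos hx hy _).const_mul (s * (s + 1))) a).sub
    (intervalIntegrable_cpow_pos hx hy (-s))

/-- on `[n + a, n + a + 1]` the periodic weight `P₂(t − a)` is the polynomial `u_{n+a}(t)`. -/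
lemma P2_eq_u (a : ℝ) (n : ℕ) {t : ℝ} (ht : t ∈ uIcc ((n : ℝ) + a) ((n : ℝ) + a + 1)) :
    P2 (t - a) = u ((n : ℝ) + a) t := by
  rw [uIcc_of_le (by linarith)] at ht
  unfold P2 u
  rcases eq_or_lt_of_le ht.2 with h | h
  · have : Int.fract (t - a) = 0 := by
      rw [h, show (n : ℝ) + a + 1 - a = ((n + 1 : ℕ) : ℝ) by push_cast; ring]
      exact Int.fract_natCast _
    rw [this, h]; ring
  · have : Int.fract (t - a) = t - a - n := by
      rw [Int.fract_eq_iff]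
      refine ⟨by linarith [ht.1], by linarith, n, by push_cast; ring⟩
    rw [this]; ring

/-- the trapezoid identity on `[n + a, n + a + 1]` with the periodic weight `P₂(t − a)`. -/
lemma interval_step (a : ℝ) (ha : 0 < a) (s : ℂ) (n : ℕ) :
    ∫ t in ((n : ℝ) + a)..((n : ℝ) + a + 1),
        ((P2 (t - a) : ℂ) * (s * (s + 1) * (t : ℂ) ^ (-s - 2)) - (t : ℂ) ^ (-s))
      = -(((((n : ℝ) + a : ℝ) : ℂ) ^ (-s) + ((((n : ℝ) + a : ℝ) : ℂ) + 1) ^ (-s)) / 2) := by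
  rw [← trapezoid ((n : ℝ) + a) (by positivity) s]
  apply integral_congr
  intro t ht
  simp only
  rw [P2_eq_u a n ht]

/-- the trapezoid identities for `n < M`, telescoped. -/
lemma sum_step (a : ℝ) (ha : 0 < a) (s : ℂ) (M : ℕ) :
    ∫ t in a..((M : ℝ) + a),
        ((P2 (t - a) : ℂ) * (s * (s + 1) * (t : ℂ) ^ (-s - 2)) - (t : ℂ) ^ (-s))
      = -(∑ n ∈ Finset.range M, ((((n : ℝ) + a : ℝ) : ℂ)) ^ (-s))
        - (((((M : ℝ) + a : ℝ) : ℂ)) ^ (-s) - (a : ℂ) ^ (-s)) / 2 := by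
  induction M with
  | zero => simp
  | succ M ih =>
    have h1 := intervalIntegrable_trap a s (x := a) (y := (M : ℝ) + a) ha (by positivity)
    have h2 := intervalIntegrable_trap a s (x := (M : ℝ) + a) (y := (M : ℝ) + a + 1)
      (by positivity) (by positivity)
    have hM : ((M + 1 : ℕ) : ℝ) + a = (M : ℝ) + a + 1 := by push_cast; ring
    rw [hM, ← integral_add_adjacent_intervals h1 h2, ih, interval_step a ha s M,
      Finset.sum_range_succ]
    push_cast
    ring

/-- **Euler–Maclaurin to second order** for the Hurwitz zeta function, `0 < a ≤ 1`, `Re s > 1`: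
`ζ(s, a) = a^{1−s}/(s−1) + a^{−s}/2 − s(s+1)·J a s`. -/
theorem hurwitzZeta_eq_EM (a : ℝ) (ha : 0 < a) (ha1 : a ≤ 1) {s : ℂ} (hs : 1 < s.re) :
    hurwitzZeta (a : UnitAddCircle) s
      = (a : ℂ) ^ (1 - s) / (s - 1) + (a : ℂ) ^ (-s) / 2 - s * (s + 1) * J a s := by
  -- the partial sums
  set S : ℕ → ℂ := fun M => ∑ n ∈ Finset.range M, ((((n : ℝ) + a : ℝ) : ℂ)) ^ (-s) with hS
  have hlim1 : Tendsto S atTop (𝓝 (hurwitzZeta (a : UnitAddCircle) s)) := by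
    have := (hasSum_hurwitzZeta_of_one_lt_re (a := a) ⟨ha.le, ha1⟩ hs).tendsto_sum_nat
    refine this.congr fun M => ?_
    simp only [hS]
    refine Finset.sum_congr rfl fun n _ => ?_
    rw [one_div, ← cpow_neg]
    push_cast
    ring_nf
  -- the explicit formula for the partial sums
  have hform : ∀ M : ℕ, S M = (∫ t in a..((M : ℝ) + a), (t : ℂ) ^ (-s))
      - s * (s + 1) * (∫ t in a..((M : ℝ) + a), (P2 (t - a) : ℂ) * (t : ℂ) ^ (-s - 2))
      + ((a : ℂ) ^ (-s) - (((M : ℝ) + a : ℝ) : ℂ) ^ (-s)) / 2 := by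
    intro M
    have h := sum_step a ha s M
    have hi1 := intervalIntegrable_cpow_pos (x := a) (y := (M : ℝ) + a) ha (by positivity) (-s - 2)
    have hi2 := intervalIntegrable_cpow_pos (x := a) (y := (M : ℝ) + a) ha (by positivity) (-s)
    rw [integral_sub (P2_mul_intervalIntegrable (hi1.const_mul (s * (s + 1))) a) hi2] at h
    have h' : ∫ t in a..((M : ℝ) + a), (P2 (t - a) : ℂ) * (s * (s + 1) * (t : ℂ) ^ (-s - 2))
        = s * (s + 1) * ∫ t in a..((M : ℝ) + a), (P2 (t - a) : ℂ) * (t : ℂ) ^ (-s - 2) := by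
      rw [← intervalIntegral.integral_const_mul]
      congr 1 with t
      ring
    rw [h'] at h
    simp only [hS]
    linear_combination h
  -- limits of the three pieces
  have hlim2 : Tendsto (fun M : ℕ => ∫ t in a..((M : ℝ) + a), (t : ℂ) ^ (-s)) atTop
      (𝓝 ((a : ℂ) ^ (1 - s) / (s - 1))) := by
    have hint : IntegrableOn (fun t : ℝ => (t : ℂ) ^ (-s)) (Ioi a) :=
      integrableOn_Ioi_cpow_of_lt (by simp; linarith) ha
    have := intervalIntegral_tendsto_integral_Ioi a hint
      (tendsto_natCast_atTop_atTop.atTop_add (tendsto_const_nhds (x := a)))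
    rw [integral_Ioi_cpow_of_lt (by simp; linarith) ha] at this
    convert this using 2
    have hs1 : s - 1 ≠ 0 := fun h0 => by
      have := congrArg Complex.re h0; simp at this; linarith
    rw [show -s + 1 = 1 - s by ring, neg_div, ← div_neg, neg_sub]
  have hlim3 : Tendsto (fun M : ℕ => ∫ t in a..((M : ℝ) + a), (P2 (t - a) : ℂ) * (t : ℂ) ^ (-s - 2))
      atTop (𝓝 (J a s)) :=
    intervalIntegral_tendsto_integral_Ioi a (integrableOn_J_integrand a ha (by linarith))
      (tendsto_natCast_atTop_atTop.atTop_add (tendsto_const_nhds (x := a)))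
  have hlim4 : Tendsto (fun M : ℕ => ((((M : ℝ) + a : ℝ) : ℂ)) ^ (-s)) atTop (𝓝 0) := by
    rw [tendsto_zero_iff_norm_tendsto_zero]
    have h1 : Tendsto (fun M : ℕ => ((M : ℝ) + a) ^ (-s.re)) atTop (𝓝 0) :=
      (tendsto_rpow_neg_atTop (by linarith : 0 < s.re)).comp
        (tendsto_natCast_atTop_atTop.atTop_add (tendsto_const_nhds (x := a)))
    refine h1.congr fun M => ?_
    rw [Complex.norm_cpow_eq_rpow_re_of_pos (by positivity)]
    simp
  have hlim5 : Tendsto S atTop (𝓝 ((a : ℂ) ^ (1 - s) / (s - 1) - s * (s + 1) * J a s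
      + ((a : ℂ) ^ (-s) - 0) / 2)) := by
    have := ((hlim2.sub (hlim3.const_mul (s * (s + 1)))).add
      ((tendsto_const_nhds (x := (a : ℂ) ^ (-s))).sub hlim4 |>.div_const 2))
    refine this.congr fun M => ?_
    rw [hform M]
  have := tendsto_nhds_unique hlim1 hlim5
  rw [this]
  ring

/-! ### Holomorphy of `J a` on `Re s > −1` (Mellin transform of a bounded kernel) -/

/-- the kernel `F a t = 1_{t > a}·P₂(t − a)`. -/
noncomputable def F (a : ℝ) : ℝ → ℂ := (Ioi a).indicator (fun t => (P2 (t - a) : ℂ))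

/-- `‖F a t‖ ≤ 1/8`. -/
lemma norm_F_le (a t : ℝ) : ‖F a t‖ ≤ 1 / 8 :=
  (norm_indicator_le_norm_self _ _).trans (norm_P2_le a t)

/-- `F a` is a.e.-strongly measurable. -/
lemma aestronglyMeasurable_F (a : ℝ) (μ : Measure ℝ) : AEStronglyMeasurable (F a) μ :=
  (aestronglyMeasurable_P2 a μ).indicator measurableSet_Ioi

/-- `J a s` is the Mellin transform of `F a` at `−s − 1`. -/
lemma J_eq_mellin (a : ℝ) (ha : 0 < a) (s : ℂ) : J a s = mellin (F a) (-s - 1) := by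
  unfold J mellin F
  have : ∀ t : ℝ, (t : ℂ) ^ (-s - 1 - 1) • (Ioi a).indicator (fun t => (P2 (t - a) : ℂ)) t
      = (Ioi a).indicator (fun t => (P2 (t - a) : ℂ) * (t : ℂ) ^ (-s - 2)) t := by
    intro t
    rw [smul_eq_mul, Set.indicator_mul_left, mul_comm, show (-s - 1 - 1 : ℂ) = -s - 2 by ring]
  simp_rw [this]
  rw [setIntegral_indicator measurableSet_Ioi, Set.Ioi_inter_Ioi, max_eq_right ha.le]

/-- `J a` is complex-differentiable at every `s` with `Re s > −1`. -/
lemma differentiableAt_J (a : ℝ) (ha : 0 < a) {s : ℂ} (hs : -1 < s.re) :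
    DifferentiableAt ℂ (J a) s := by
  have hfc : LocallyIntegrableOn (F a) (Ioi 0) :=
    ((memLp_top_of_bound (aestronglyMeasurable_F a volume) (1 / 8)
      (Eventually.of_forall (norm_F_le a))).locallyIntegrable le_top).locallyIntegrableOn _
  have h_top : F a =O[atTop] (fun t : ℝ => t ^ (-(0 : ℝ))) := by
    refine Asymptotics.IsBigO.of_bound (1 / 8) ?_
    filter_upwards [eventually_gt_atTop (0 : ℝ)] with t ht
    rw [neg_zero, Real.rpow_zero, norm_one, mul_one]
    exact norm_F_le a t
  have h_bot : F a =O[𝓝[>] 0] (fun t : ℝ => t ^ (-(-s.re - 2))) := by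
    refine Asymptotics.IsBigO.of_bound 0 ?_
    filter_upwards [Ioo_mem_nhdsGT ha] with t ht
    have : F a t = 0 := by
      unfold F
      exact Set.indicator_of_notMem (by simp; exact ht.2.le) _
    rw [this, norm_zero, zero_mul]
  have hs1 : (-s - 1).re < 0 := by
    simp only [Complex.sub_re, Complex.neg_re, Complex.one_re]; linarith
  have hs2 : -s.re - 2 < (-s - 1).re := by
    simp only [Complex.sub_re, Complex.neg_re, Complex.one_re]; linarith
  have hd := mellin_differentiableAt_of_isBigO_rpow (E := ℂ) hfc h_top hs1 h_bot hs2
  have hJ : J a = fun s => mellin (F a) (-s - 1) := funext (J_eq_mellin a ha)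
  rw [hJ]
  have hf : DifferentiableAt ℂ (fun s : ℂ => -s - 1) s :=
    (differentiableAt_id (𝕜 := ℂ) (x := s)).neg.sub_const 1
  exact DifferentiableAt.comp (g := mellin (F a)) (f := fun s : ℂ => -s - 1) s hd hf

/-! ### The identity theorem -/

/-- `Φ a s = (s − 1)·ζ(s, a)`, written so that it is visibly entire. -/
noncomputable def Phi (a : UnitAddCircle) (s : ℂ) : ℂ :=
  (s - 1) * (hurwitzZeta a s - 1 / (s - 1) / Gammaℝ s) + 1 / Gammaℝ s

/-- `Φ a s = (s − 1)·ζ(s, a)` for `s ≠ 1`. -/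
lemma Phi_eq (a : UnitAddCircle) {s : ℂ} (hs : s ≠ 1) :
    Phi a s = (s - 1) * hurwitzZeta a s := by
  have h : s - 1 ≠ 0 := sub_ne_zero.2 hs
  unfold Phi; field_simp; ring

/-- `Φ a` is entire. -/
lemma differentiable_Phi (a : UnitAddCircle) : Differentiable ℂ (Phi a) := by
  intro s
  have hG : DifferentiableAt ℂ (fun s : ℂ => 1 / Gammaℝ s) s := by
    simp only [one_div]; exact differentiable_Gammaℝ_inv.differentiableAt
  by_cases hs : s = 1
  · subst hs
    exact ((differentiableAt_id.sub_const 1).mul <|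
      differentiableAt_hurwitzZeta_sub_one_div a).add hG
  · have h1 : DifferentiableAt ℂ (hurwitzZeta a) s := differentiableAt_hurwitzZeta a hs
    have h2 : DifferentiableAt ℂ (fun s : ℂ => 1 / (s - 1) / Gammaℝ s) s := by
      simp only [div_eq_mul_inv, one_mul]
      have hinv : DifferentiableAt ℂ (fun s : ℂ => (s - 1)⁻¹) s :=
        (differentiableAt_id.sub_const 1).inv (sub_ne_zero.2 hs)
      exact hinv.mul differentiable_Gammaℝ_inv.differentiableAt
    exact ((differentiableAt_id.sub_const 1).mul (h1.sub h2)).add hG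

/-- the right-hand side of the Euler–Maclaurin formula times `(s − 1)`. -/
noncomputable def Rt (a : ℝ) (s : ℂ) : ℂ :=
  (a : ℂ) ^ (1 - s) + (s - 1) * (a : ℂ) ^ (-s) / 2 - (s - 1) * (s * (s + 1)) * J a s

/-- `Rt a` is holomorphic on the half plane `Re s > −1`. -/
lemma differentiableOn_Rt (a : ℝ) (ha : 0 < a) :
    DifferentiableOn ℂ (Rt a) {s : ℂ | -1 < s.re} := by
  intro s hs
  apply DifferentiableAt.differentiableWithinAt
  unfold Rt
  have ha' : (a : ℂ) ≠ 0 := by exact_mod_cast ha.ne'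
  have e1 : DifferentiableAt ℂ (fun s : ℂ => (a : ℂ) ^ (1 - s)) s :=
    ((differentiableAt_const _).sub differentiableAt_id).const_cpow (Or.inl ha')
  have e2 : DifferentiableAt ℂ (fun s : ℂ => (s - 1) * (a : ℂ) ^ (-s) / 2) s :=
    ((differentiableAt_id.sub_const 1).mul <|
      differentiableAt_id.neg.const_cpow (Or.inl ha')).div_const 2
  have e3 : DifferentiableAt ℂ (fun s : ℂ => (s - 1) * (s * (s + 1)) * J a s) s :=
    ((differentiableAt_id.sub_const 1).mul <|
      differentiableAt_id.mul <| differentiableAt_id.add_const 1).mul (differentiableAt_J a ha hs)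
  exact (e1.add e2).sub e3

/-- **The value of the Hurwitz zeta function at `s = 0`**: `ζ(0, a) = 1/2 − a` for `0 < a ≤ 1`
(the case left open in Mathlib's `HurwitzZeta.hurwitzZeta_neg_nat`, proved here by second-order
Euler–Maclaurin summation and the identity theorem, with no Fourier series). -/
theorem hurwitzZeta_zero_eq (a : ℝ) (ha : 0 < a) (ha1 : a ≤ 1) :
    hurwitzZeta (a : UnitAddCircle) 0 = 1 / 2 - a := by
  set U : Set ℂ := {s : ℂ | -1 < s.re} with hUdef
  have hU : IsOpen U := isOpen_lt continuous_const Complex.continuous_re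
  have hUc : IsPreconnected U := (convex_halfSpace_re_gt (-1)).isPreconnected
  have hPhi : AnalyticOnNhd ℂ (Phi a) U :=
    (differentiable_Phi a).differentiableOn.analyticOnNhd hU
  have hRt : AnalyticOnNhd ℂ (Rt a) U := (differentiableOn_Rt a ha).analyticOnNhd hU
  have h2 : (2 : ℂ) ∈ U := by norm_num [hUdef]
  have heq : Phi a =ᶠ[𝓝 (2 : ℂ)] Rt a := by
    have hV : {s : ℂ | 1 < s.re} ∈ 𝓝 (2 : ℂ) :=
      (isOpen_lt continuous_const Complex.continuous_re).mem_nhds (by norm_num)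
    filter_upwards [hV] with s hs
    have hs1 : s ≠ 1 := by rintro rfl; simp at hs
    rw [Phi_eq a hs1, hurwitzZeta_eq_EM a ha ha1 hs]
    unfold Rt
    have h : s - 1 ≠ 0 := sub_ne_zero.2 hs1
    field_simp
  have hEq := hPhi.eqOn_of_preconnected_of_eventuallyEq hRt hUc h2 heq
  have h0 : (0 : ℂ) ∈ U := by simp [hUdef]
  have key := hEq h0
  rw [Phi_eq a (by norm_num)] at key
  unfold Rt at key
  simp only [sub_zero, cpow_one, neg_zero, cpow_zero, zero_sub, zero_mul, mul_one, zero_add,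
    mul_zero, sub_zero] at key
  linear_combination -key

end HodgeRepro.Lit2.HurwitzZero
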